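import Mathlib.MeasureTheory.Integral.MeanInequalities
import Mathlib.MeasureTheory.Integral.Lebesgue.Countable
import Literature.Barriers.NavierStokesRegularity.CriticalDataSmoothNonuniquenessProofs
import Literature.Analysis.FunctionSpaces.TorusSobolevNormFacts
import Literature.Analysis.FunctionSpaces.HolderNorm
import Literature.Analysis.FunctionSpaces.HolderAlgebra
import HarnessLib

/-!
# Coiculescu–Palasek 2025, the finite-time construction: proof architecture one level down —
  the principal parts with their residuals (§3, Prop. 4.1, §5) as the explicit remaining
  obligation, the first rendering of the perturbation theorem (Props. 4.2–4.3; REFUTED as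
  stated, kept as a deprecated record), the §5 assembly proved

STATUS (named-fact verdict clean-up, 2026-08-16). The one named fact this file introduced,
`CoiculescuPalasek2025_perturbation` — Props. 4.2–4.3 abstracted to EVERY approximate solution and
EVERY Hölder exponent `κ ∈ (0, 1/2 - 4α)`, with the `Ċ^{1,κ}` slot of `‖w‖_X ≤ ε₁` in the
conclusion — is REFUTED AS STATED in the tree, by
`Literature.Barriers.NavierStokesRegularity.not_CoiculescuPalasek2025_perturbation` (sibling file
`CriticalDataSmoothNonuniquenessPerturbationRefuted`: a forced one-mode shear flow at `α = 1/16`,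
`κ = 1/5`; the mechanism is recorded in the section "Correction (2026-08-15)" at the end of this
file), and is therefore RETIRED from the named-fact debt: no
`CoiculescuPalasek2025_perturbation_holds` can exist. Re-verified for the clean-up against the
source: the printed proof of Prop. 4.2 runs its second Grönwall argument for
`h(t) = (t-t')^{1/2} t^{(1+κ)/2} ‖∇S(t,t')‖_{C^κ}` (arXiv version p. 19, "Thus, defining `h(t) = …` …
We conclude once again by Lemma B.3"), so the gradient of the semigroup is bounded with the
weight `t^{-(1+κ)/2}`, not the stated `t^{-1/2+ε}`, and Prop. 4.3 then closes in `X` only for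
`κ ≤ α` — immaterial in print, where `κ` is a free parameter, fatal for the abstraction. The
definition is KEPT, statement byte-for-byte, as a `@[deprecated]` RECORD (not deleted) because the
refutation theorem and the first assembly name it (`CoiculescuPalasek2025_construction_of_parts`
below — deprecated with it, its hypothesis `hB` being the refuted statement — and
`CriticalDataSmoothNonuniqueness_of_principalParts_of_perturbation` in `…Assembly`). What replaced
it, all in files importing this one (hence cited here by name only): (a) the statement the printed
proof supports — the same statement with the additional hypothesis `κ ≤ α`, resp. for `κ` below
a threshold `κ₁(α, K, C)` — carried, as a proof obligation of the barrier and not a named fact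
(D-0026), as the explicit hypothesis `hB` of `CoiculescuPalasek2025_construction_of_parts'`
(`…CorrectedAssembly`) and of `CoiculescuPalasek2025_construction_of_parts_of_threshold`,
`CriticalDataSmoothNonuniqueness_of_principalParts_of_perturbationThreshold/…Le`
(`…ThresholdAssembly`); (b) the REDUCED perturbation step — the five conclusions the §5 assembly
consumes (classical solution `v + w`, zero mean, the `L^∞` slot `t^{(1-α)/2}‖w‖ ≤ ε₁`,
`‖w(t)‖_{Ḣ^{-1}} → 0`, pairings `→ 0`), without the `Ċ^{1,κ}` slot — PROVED for every `κ`: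
`CoiculescuPalasek2025_perturbation_reduced` (`…PerturbationReduced`), whence
`CriticalDataSmoothNonuniqueness_of_principalParts`, the barrier fact from the principal parts
`hA` alone. The groundwork of this file (the bundle `CoiculescuPalasek2025.IsApproximateSolution`,
`unitTime`, `matrixDiv`, the `Ḣ^{-1}` triangle inequalities, the exponent monotonicity
`IsApproximateSolution.of_exponent_le`) is live and is what all of them are built on. The rest of
this docstring describes the file as designed (2026-08-15), with the status of item 2 marked.

Second sibling proof file of the barrier entry
`Literature/Barriers/NavierStokesRegularity/CriticalDataSmoothNonuniqueness` (D-0021), below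
`CriticalDataSmoothNonuniquenessProofs`, whose FINITE-TIME CONSTRUCTION — the explicit hypothesis
`h₁` of the assembly theorem `CriticalDataSmoothNonuniqueness_of_parts` there (M. P. Coiculescu,
S. Palasek, *Non-uniqueness of smooth solutions of the Navier–Stokes equations from critical
data*, Invent. Math. 244 (2025), 165–219, arXiv:2503.14699: everything of §§3–4 and of §5 up to
its last paragraph, on the paper's `(0,1] × 𝕋³`; briefly the named fact
`CoiculescuPalasek2025_construction`, merged back into the barrier's proof obligation on split
review — D-0026: fact decompositions do not recurse) — is the target here; since the other
hypothesis of that assembly, the small-data global extension, is discharged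
(`CoiculescuPalasek2025_globalExtension_holds`, sibling file
`CriticalDataSmoothNonuniquenessGlobal`, which this file does not import), proving the
finite-time construction from the principal parts and the perturbation theorem below yields the
barrier fact `CriticalDataSmoothNonuniqueness` from them as well, by the one-line composition
`CriticalDataSmoothNonuniqueness_of_parts (CoiculescuPalasek2025_construction_of_parts hA hB)
CoiculescuPalasek2025_globalExtension_holds` (sibling file
`CriticalDataSmoothNonuniquenessAssembly`). Triage:
SIZE XL (a theory: Mikado-potential datum iteration, multiscale bounds, residual estimates, the
semigroup of the linearisation with a fractional Grönwall inequality, a fixed point in a slightly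
subcritical space, over torus Littlewood–Paley / Hölder–Zygmund / heat-semigroup calculus the
tree does not have). This file formalises the NEXT level of the printed proof: the seam, drawn
by the paper itself at the start of §5 —

> "We have shown that for `i ∈ {1,2}`, there exist `v⁽ⁱ⁾ ∈ C^∞((0,1] × 𝕋³)` and
> `w⁽ⁱ⁾ ∈ C⁰((0,1]; C^{1,κ})` obeying suitable equations such that `u⁽ⁱ⁾ = v⁽ⁱ⁾ + w⁽ⁱ⁾` obey (NSE)."

— between

1. the PRINCIPAL PARTS AND THEIR RESIDUALS (Def. 3.10, Prop. 3.13, Prop. 4.1, and the three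
   estimates of §5 that concern `v⁽ⁱ⁾` alone: datum, distinctness at `t₀ = N₀⁻²`, smallness at
   `t = 1`), an EXISTENTIAL statement about the paper's explicit objects `(v⁽ⁱ⁾, F⁽ⁱ⁾)`. This is
   the whole of §3 with §4.1 — Mikado potentials and their supports (Def. 3.1, Lemmas 3.2–3.3),
   the inductive datum (Defs. 3.4–3.5, Lemma 3.6, Prop. 3.7 with its two-sided bounds,
   Prop. 3.8, Def. 3.9), the two continuations (Def. 3.10, Prop. 3.13), the residuals and their
   term-by-term estimates (eq. (4.1), Prop. 4.1, with the anti-divergence operator and the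
   stationary-phase lemma of App. A and the Calderón–Zygmund boundedness of `∇𝓡` on `C^κ(𝕋³)`),
   over the torus Littlewood–Paley and heat-multiplier estimates of §2.2 / App. C — a slice of
   the proof of
   Thm. 1.2 and itself a theory (SIZE XL), not a distinct M-sized published result; so (D-0026:
   fact decompositions do not recurse; children of a split are distinct M-sized published
   results) it is NOT a named fact: it is the remaining proof obligation of the barrier fact,
   and appears below only as the EXPLICIT hypothesis `hA` of the assembly theorem
   `CoiculescuPalasek2025_construction_of_parts` (and, verbatim, of
   `CriticalDataSmoothNonuniqueness_of_principalParts_of_perturbation` in the assembly file). (It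
   was briefly the named fact `CoiculescuPalasek2025_principalParts`; merged back on split review,
   2026-08-15, its prove-seat having confirmed the XL triage.) And
2. the PERTURBATION THEOREM (Props. 4.2–4.3 with App. B and the first paragraph of §5), first
   vendored (2026-08-15) as the named fact `CoiculescuPalasek2025_perturbation` — REFUTED AS
   STATED and now a deprecated record, see STATUS above — in abstracted form: for EVERY smooth
   divergence-free `v` and smooth symmetric `F` on `(0,1] × 𝕋³` related by (4.1) and obeying the
   two displayed bounds of Prop. 3.13 and the `Y`-bound of Prop. 4.1 with `ε₀` small and the
   lacunarity slope `(log A)⁻¹` small, and for EVERY `κ ∈ (0, 1/2 - 4α)`, there is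
   `w ∈ B_X(0, ε₁)` with `v + w` a smooth solution of (NSE) on `(0,1]` and `w(t) → 0` as `t → 0`.
   (The rendering read the hypotheses off the printed proofs of Props. 4.2–4.3, which invoke
   nothing else about `v⁽ⁱ⁾`, `F⁽ⁱ⁾` — see the docstring of the record for the line-by-line
   account; the paper flags the abstraction before Prop. 4.2: "If `v⁽ⁱ⁾` were an arbitrary vector
   field in, say, the Koch–Tataru space `X_KT` and additionally obeyed (3.13a), we do not expect
   the loss would be so mild. … Fortunately, due to `v⁽ⁱ⁾` being supported on a lacunary sequence
   of scales, quantities such as `‖v⁽ⁱ⁾‖_{L²_t([t',t];L^∞_x)}` can be arranged to deteriorate as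
   slowly as desired as `t'/t → 0`; see the proof of Proposition 3.13." What it missed is the
   range of `κ`: the printed proof delivers the `Ċ^{1,κ}` slot of the conclusion only for `κ ≤ α`
   — see the correction section at the end of this file — and for `κ(1-2α) > α` the abstraction
   is false.)

The shared list of properties — what Prop. 3.13, (4.1) and Prop. 4.1 assert of one pair
`(v⁽ⁱ⁾, F⁽ⁱ⁾)` — is the `Prop`-valued structure `CoiculescuPalasek2025.IsApproximateSolution`, so that
the conclusion of hypothesis `hA` is literally the hypothesis of the perturbation fact.

Labels used throughout (ours): (3.13a) is the first displayed estimate of Prop. 3.13,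
`‖∇^m v⁽ⁱ⁾(t)‖_{L^∞(𝕋³)} ≲_m t^{-(m+1)/2} e^{-N₀²t/O_m(1)}` for all `m ≥ 0`, `t > 0`; (3.13b) is the
second, `‖v⁽ⁱ⁾‖²_{L²([t₁,t₂],dt;L^∞)} + ‖v⁽ⁱ⁾‖_{L¹([t₁,t₂],t^{-1/2}dt;L^∞)} ≲ 1 + (log A)⁻¹ log(t₂/t₁)` for
`0 < t₁ ≤ t₂ ≤ 1`; (4.1) is the defining identity of the residuals at the head of §4.1,
`-ℙ div F⁽ⁱ⁾ = ∂ₜv⁽ⁱ⁾ - Δv⁽ⁱ⁾ + ℙ div v⁽ⁱ⁾ ⊗ v⁽ⁱ⁾`; `‖a‖_Y = sup_{t∈(0,1]} (t^{1-α}‖a‖_{L^∞} + t^{3/2-α}‖∇a‖_{C^κ})`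
(§4.2) and `‖V‖_X = sup_{t∈(0,1]} (t^{1/2-α/2}‖V‖_{L^∞} + t^{1-α/2}‖∇V‖_{C^κ})` (§4.3).

Proved here:

* `CoiculescuPalasek2025_construction_of_parts` — the principal parts (explicit hypothesis `hA`)
  and the perturbation fact imply the finite-time construction (stated explicitly, literally
  the hypothesis `h₁` of `CriticalDataSmoothNonuniqueness_of_parts`). DEPRECATED (2026-08-16)
  together with the record it consumes: its hypothesis `hB` is the refuted statement, so the
  implication is vacuous; the same Lean proof at fixed parameters over the reduced perturbation
  step is `CoiculescuPalasek2025.construction_of_parts_at` (`…ThresholdAssembly`), and the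
  non-vacuous assemblies are listed under STATUS. Its proof is the Lean content of
  the rest of §5: with `α` fixed, take `κ`, the constants and then `C₄`; given the target `ε`,
  choose `ε₁ < C₄⁻¹` also so small that `ε₁ T_*^{-(1-α)/2} ≤ ε/2`; take `ε₀`, `η` from the
  perturbation fact and run `hA` with distinctness margin `3ε₁` and final smallness `ε/2`;
  perturb both principal parts. Then: `uⁱ = vⁱ + wⁱ` are classical solutions on `(0, T_*]`
  (perturbation fact); `√t‖uⁱ(t)‖_∞ ≤ |K₀| + ε₁` ((3.13a) with `m = 0`, and
  `√t · ε₁ t^{-(1-α)/2} = ε₁ t^{α/2} ≤ ε₁`); distinct at `t₀` (§5: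
  `‖v¹(t₀) - v²(t₀)‖ ≥ 3ε₁ t₀^{-(1-α)/2} > ‖w¹(t₀)‖ + ‖w²(t₀)‖`); common datum (triangle
  inequality in `Ḣ^{-1}` — `eHomSobolevSeminorm_add_le` — and additivity of the pairings); zero
  mean and `‖uⁱ(T_*)‖_∞ ≤ ε/2 + ε/2` at the final time.
* `eHomSobolevSeminorm_add_le`, `eHomSobolevSeminorm_neg` — Minkowski in the weighted `ℓ²(ℤᵈ∖0)`
  defining `Ḣ^s(𝕋ᵈ)` (twin of `Torus.eSobolevNorm_add_le_holds`), and their complexified forms;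
* `CoiculescuPalasek2025.IsApproximateSolution.sqrt_mul_norm_le` — the `m = 0` case of (3.13a)
  read pointwise;
* `CoiculescuPalasek2025.IsApproximateSolution.of_exponent_le` and its lemmas (correction
  section): the property bundle is monotone under decreasing the Hölder exponent.

## Rendering notes

* Transport. As in the sibling file, the `2π`-periodic setting is moved to `UnitAddTorus (Fin 3)`
  by the Navier–Stokes scaling `x ↦ 2πx`, `t ↦ 4π²t` (which keeps `ν = 1`); the paper's unit time
  interval `(0,1]` becomes `(0, T_*]`, `T_* = CoiculescuPalasek2025.unitTime = (4π²)⁻¹ ≤ 1`. All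
  multiplicative constants produced by the transport are absorbed in the quantified constants
  (`K`, `C`, `ε₀`, `ε₁`, `C₄`), so hypothesis `hA` and the perturbation fact are stated directly
  on `(0, T_*] × (ℝ/ℤ)³`.
* (4.1) `-ℙ div F⁽ⁱ⁾ = ∂ₜv⁽ⁱ⁾ - Δv⁽ⁱ⁾ + ℙ div v⁽ⁱ⁾ ⊗ v⁽ⁱ⁾` is recorded in classical form, as the
  tree's `Torus.IsClassicalNSSolutionOn (Ioc 0 T) 1 (-div F) v π` with a smooth pressure `π`:
  for smooth, mean-zero, divergence-free `v` the two are equivalent (`div (v ⊗ v) = (v·∇)v`;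
  `π = -Δ⁻¹ div div (v ⊗ v + F)` by Leray–Helmholtz on `𝕋³`; conversely apply `ℙ`, which fixes the
  mean-zero divergence-free fields `∂ₜv`, `Δv`). Symmetric tensors `S^{3×3}` live in the Pi type
  `Fin 3 → Fin 3 → ℝ` (sup norm; the convention of `Literature.Analysis.FluidPDE.CP25`) with a
  symmetry clause; `(div F)_i = Σ_j ∂_j F_{ij}` is `CoiculescuPalasek2025.matrixDiv`. The paper's
  `L^∞` norms of tensors are Frobenius-based; the discrepancy is a factor `≤ 3`, absorbed in `ε₀`.
* Norms. `‖∇^m v(t)‖_{L^∞}` is `eSupNorm (iteratedFDeriv ℝ m (Torus.lift (v t)))` (periodic lift,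
  the convention of `Torus.eContDiffHolderNorm`); the homogeneous Hölder seminorm `‖∇a‖_{C^κ}` of
  §2.3 ("`𝒞^s` and `C^s` defined as above are homogeneous") is Mathlib's `eHolderNorm κ` of
  `iteratedFDeriv ℝ 1 (Torus.lift a)`; `‖v(s)‖_{L^∞}` inside the time integrals of (3.13b) is
  `(eSupNorm (v s)).toReal`. The exponential factor `e^{-N₀²t/O_m(1)}` of (3.13a) is dropped
  (weaker; its only use, smallness at `t = 1`, is a separate clause).
* Weaker-than-print conclusions (all implied by print, chosen to be consumable by the
  assembly over accepted notions, exactly as in the sibling files): "`w⁽ⁱ⁾(t) → 0` in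
  `𝒞^{-1+α/2}`" (Prop. 4.3) is rendered as `‖w(t)‖_{Ḣ^{-1}} → 0` (on `𝕋³`,
  `‖f‖²_{Ḣ^{-1}} = Σ_N Σ_{|k|∼N} |k|⁻²|f̂(k)|² ≲ Σ_N N^{-α} ‖f‖²_{𝒞^{-1+α/2}}`) plus convergence to `0`
  of the pairings with smooth mean-zero fields (duality); "`v⁽ⁱ⁾(t) → U⁰` in `Ẇ^{-1,p}`,
  `1 < p < ∞`" (§5) is rendered for `p = 2` (`Ẇ^{-1,2} = Ḣ^{-1}`, `Torus.eHomSobolevSeminorm (-1)`)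
  as: `‖v¹(t) - v²(t)‖_{Ḣ^{-1}} → 0`, each `vⁱ(t)` Cauchy in `Ḣ^{-1}`, and the pairings of `v¹(t)`,
  `v²(t)` with a smooth mean-zero `φ` converge to a common limit (`⟨U⁰, φ⟩`), sidestepping the
  distribution `U⁰`; "`w ∈ B_X(0, ε₁)`" is rendered slot by slot
  (`sup_t t^{1/2-α/2}‖w(t)‖_∞ ≤ ε₁`, pointwise in `x`, and `sup_t t^{1-α/2}‖∇w(t)‖_{C^κ} ≤ ε₁`);
  sup-norm lower/upper bounds at single times are written pointwise (`∃ x₀`, `∀ x`), equivalent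
  for continuous fields on the compact torus.
* Parameters (§2.4). `α ∈ (0, 1/8)` is free; `b > 5 ∨ (1-8α)⁻¹`, `(1-4α)⁻¹ < γ < (4α + b⁻¹)⁻¹`,
  `κ ∈ (0, 1/2 - 1/(2γ) - 2α)` — so every admissible `κ` satisfies `κ < 1/2 - 4α`, the range used
  below; `δ`, `δ₀` and the other auxiliary exponents are then fixed; "the implicit constants … may
  depend on `α, β, γ, δ, δ₀, ε, κ, b, c₁` but not `A`", and "the scale parameter `A` … is taken to be
  as large as needed, depending on all the other parameters". Accordingly hypothesis `hA`
  produces `κ` and the constants `K`, `C` first and meets every smallness target afterwards (by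
  `A` large: `ε₀` of Prop. 4.1, the slope `η ∝ (log A)⁻¹` of (3.13b), the distinctness margin and
  the smallness at the final time of §5), and the perturbation fact has the quantifier shape of
  Prop. 4.3 ("there exists `C₄ > 0` such that for all `ε₁ ∈ (0, C₄⁻¹)` and sufficiently large
  `A`"), with "`A` large" spelled as "`ε₀` and `η` small".

## References

* M. P. Coiculescu, S. Palasek, Invent. Math. 244 (2025), 165–219,
  doi:10.1007/s00222-025-01396-z, arXiv:2503.14699: §2.3 (spaces), §2.4 (parameters), §3.1
  (Def. 3.1, Lemmas 3.2–3.3), §3.2 (Defs. 3.4–3.5, Lemma 3.6, Props. 3.7–3.8, Def. 3.9), §3.3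
  (Def. 3.10, Rmks. 3.11–3.12, Prop. 3.13), §4.1 eq. (4.1) and Prop. 4.1, §4.2 (space `Y`,
  semigroup `S⁽ⁱ⁾`) and Prop. 4.2, §4.3 (space `X`) and Prop. 4.3, §5, App. A (Lemma A.1, Def. A.2,
  Lemmas A.3–A.5), App. B (Prop. B.1, Lemmas B.2–B.3) and App. C (Lemma C.1, proofs of
  Lemmas 2.1–2.2) — the appendices are numbered §§6–8 in the arXiv version.
  [`CoiculescuPalasek2025`]
* L. Grafakos, *Classical Fourier Analysis*, 3rd ed. (2014), §3.1.1, §3.3 (Fourier coefficients,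
  Sobolev norms on `𝕋ᵈ`). [`Grafakos2014`]
-/

noncomputable section

open MeasureTheory Set Filter UnitAddTorus
open _root_.Topology
open scoped InnerProductSpace RealInnerProductSpace ENNReal NNReal

namespace Literature.Barriers.NavierStokesRegularity

open Literature.Analysis.FunctionSpaces


/-! ## Glue: the triangle inequality in `Ḣ^s(𝕋ᵈ)` -/

section HomSobolev

variable {d : Type*} [Fintype d]
variable {E : Type*} [NormedAddCommGroup E] [NormedSpace ℂ E]

/-- **Triangle inequality for the homogeneous Sobolev seminorm** `|f + g|_{Ḣ^s} ≤ |f|_{Ḣ^s} + |g|_{Ḣ^s}`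
for integrable `f, g : 𝕋ᵈ → E` and every `s ∈ ℝ`: Minkowski's inequality in the weighted
`ℓ²(ℤᵈ ∖ 0)` (`MeasureTheory.ENNReal.lintegral_Lp_add_le` for the counting measure, applied to
`k ↦ w_k^{1/2} ‖f̂(k)‖` with `w_k = |k|^{2s}` for `k ≠ 0`, `w_0 = 0`) after `𝓕(f+g) = 𝓕f + 𝓕g`
(`Torus.mFourierCoeff_add`; Grafakos, §3.1.1, §3.3). Twin of `Torus.eSobolevNorm_add_le_holds`.
[folklore] -/
theorem eHomSobolevSeminorm_add_le (s : ℝ) {f g : UnitAddTorus d → E} (hf : Integrable f volume)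
    (hg : Integrable g volume) :
    Torus.eHomSobolevSeminorm s (f + g) ≤
      Torus.eHomSobolevSeminorm s f + Torus.eHomSobolevSeminorm s g := by
  set w : (d → ℤ) → ℝ≥0∞ := fun k =>
    (if k = 0 then 0 else ENNReal.ofReal (Torus.freqNormSq k ^ s)) ^ (1 / (2 : ℝ)) with hw
  have key : ∀ u : UnitAddTorus d → E, Torus.eHomSobolevSeminorm s u =
      (∫⁻ k, (fun k => w k * ‖mFourierCoeff u k‖ₑ) k ^ (2 : ℝ) ∂Measure.count) ^ (1 / (2 : ℝ)) := by
    intro u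
    rw [lintegral_count, Torus.eHomSobolevSeminorm]
    congr 1
    refine tsum_congr fun k => ?_
    simp only [hw]
    rw [ENNReal.mul_rpow_of_nonneg _ _ (by norm_num : (0 : ℝ) ≤ 2), ← ENNReal.rpow_mul,
      ENNReal.rpow_two]
    norm_num
  rw [key, key, key]
  calc (∫⁻ k, (fun k => w k * ‖mFourierCoeff (f + g) k‖ₑ) k ^ (2 : ℝ) ∂Measure.count) ^
        (1 / (2 : ℝ))
      ≤ (∫⁻ k, ((fun k => w k * ‖mFourierCoeff f k‖ₑ) +
            (fun k => w k * ‖mFourierCoeff g k‖ₑ)) k ^ (2 : ℝ) ∂Measure.count) ^ (1 / (2 : ℝ)) := by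
        gcongr with k
        simp only [Pi.add_apply]
        rw [← mul_add, Torus.mFourierCoeff_add hf hg]
        exact mul_le_mul' le_rfl (enorm_add_le _ _)
    _ ≤ _ := ENNReal.lintegral_Lp_add_le (Measurable.of_discrete.aemeasurable)
          (Measurable.of_discrete.aemeasurable) (by norm_num)

/-- `|-f|_{Ḣ^s} = |f|_{Ḣ^s}` (`𝓕(-f) = -𝓕f`, no integrability needed). [folklore] -/
@[simp]
theorem eHomSobolevSeminorm_neg (s : ℝ) (f : UnitAddTorus d → E) :
    Torus.eHomSobolevSeminorm s (-f) = Torus.eHomSobolevSeminorm s f := by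
  have h : ∀ k : d → ℤ, mFourierCoeff (-f) k = -mFourierCoeff f k := fun k => by
    simp [mFourierCoeff, integral_neg]
  simp only [Torus.eHomSobolevSeminorm, h, enorm_neg]

end HomSobolev

/-- `complexify ∘ (f + g) = complexify ∘ f + complexify ∘ g` (linearity). [folklore] -/
theorem complexify_comp_add {ι X : Type*} [Fintype ι] (f g : X → EuclideanSpace ℝ ι) :
    EuclideanSpace.complexify ∘ (f + g) =
      EuclideanSpace.complexify ∘ f + EuclideanSpace.complexify ∘ g := by
  funext x
  simp [map_add]

/-- `complexify ∘ (-f) = -(complexify ∘ f)` (linearity). [folklore] -/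
theorem complexify_comp_neg {ι X : Type*} [Fintype ι] (f : X → EuclideanSpace ℝ ι) :
    EuclideanSpace.complexify ∘ (-f) = -(EuclideanSpace.complexify ∘ f) := by
  funext x
  simp

/-- Triangle inequality in `Ḣ^s(𝕋³)` for complexified continuous real fields:
`|f + g|_{Ḣ^s} ≤ |f|_{Ḣ^s} + |g|_{Ḣ^s}` (continuity gives the integrability that makes the
Fourier coefficients genuine). [folklore] -/
theorem eHomSobolevSeminorm_complexify_add_le (s : ℝ)
    {f g : UnitAddTorus (Fin 3) → EuclideanSpace ℝ (Fin 3)} (hf : Continuous f)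
    (hg : Continuous g) :
    Torus.eHomSobolevSeminorm s (EuclideanSpace.complexify ∘ (f + g)) ≤
      Torus.eHomSobolevSeminorm s (EuclideanSpace.complexify ∘ f) +
        Torus.eHomSobolevSeminorm s (EuclideanSpace.complexify ∘ g) := by
  rw [complexify_comp_add]
  exact eHomSobolevSeminorm_add_le s
    (Torus.integrable_complexify_comp
      (hf.integrable_of_hasCompactSupport (HasCompactSupport.of_compactSpace _)))
    (Torus.integrable_complexify_comp
      (hg.integrable_of_hasCompactSupport (HasCompactSupport.of_compactSpace _)))

/-- Triangle inequality in `Ḣ^s(𝕋³)` for a difference of complexified continuous real fields: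
`|f - g|_{Ḣ^s} ≤ |f|_{Ḣ^s} + |g|_{Ḣ^s}`. [folklore] -/
theorem eHomSobolevSeminorm_complexify_sub_le (s : ℝ)
    {f g : UnitAddTorus (Fin 3) → EuclideanSpace ℝ (Fin 3)} (hf : Continuous f)
    (hg : Continuous g) :
    Torus.eHomSobolevSeminorm s (EuclideanSpace.complexify ∘ (f - g)) ≤
      Torus.eHomSobolevSeminorm s (EuclideanSpace.complexify ∘ f) +
        Torus.eHomSobolevSeminorm s (EuclideanSpace.complexify ∘ g) := by
  rw [sub_eq_add_neg]
  refine (eHomSobolevSeminorm_complexify_add_le s hf hg.neg).trans ?_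
  rw [complexify_comp_neg, eHomSobolevSeminorm_neg]

/-- Pairings of continuous fields on the compact torus are integrable. [folklore] -/
theorem integrable_inner_of_continuous {f φ : UnitAddTorus (Fin 3) → EuclideanSpace ℝ (Fin 3)}
    (hf : Continuous f) (hφ : Continuous φ) :
    Integrable (fun x => ⟪f x, φ x⟫) volume :=
  (hf.inner hφ).integrable_of_hasCompactSupport (HasCompactSupport.of_compactSpace _)

/-! ## The paper's unit of time, tensor divergence, and the shared hypothesis bundle -/

namespace CoiculescuPalasek2025

/-- **The paper's unit time on the unit torus.** Coiculescu–Palasek work on `𝕋³ = ℝ³/(2πℤ)³` and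
carry the construction (the spaces `X`, `Y`, Props. 4.1–4.3, §5) on the time interval `(0,1]`
(§4.3, footnote: "we only execute the fixed point argument up to time `t = 1`"). Under the
Navier–Stokes scaling `x ↦ 2πx`, `t ↦ 4π²t`, which transports `ν = 1` solutions on `ℝ³/(2πℤ)³` to
`ν = 1` solutions on `UnitAddTorus (Fin 3) = (ℝ/ℤ)³`, that interval becomes `(0, T_*]` with
`T_* = (4π²)⁻¹`. [cite: CoiculescuPalasek2025, §4.3 (footnote) and Rmk. 1.7] -/
def unitTime : ℝ := (4 * Real.pi ^ 2)⁻¹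

/-- `unitTime = (4π²)⁻¹`. [folklore] -/
theorem unitTime_def : unitTime = (4 * Real.pi ^ 2)⁻¹ := rfl

/-- `0 < T_*`. [folklore] -/
theorem unitTime_pos : 0 < unitTime := by
  rw [unitTime_def]
  positivity

/-- `T_* ≤ 1` (`4π² ≥ 1`). [folklore] -/
theorem unitTime_le_one : unitTime ≤ 1 := by
  rw [unitTime_def]
  have hπ : (1 : ℝ) ≤ Real.pi := le_trans (by norm_num) Real.two_le_pi
  have h : (1 : ℝ) ≤ 4 * Real.pi ^ 2 := by nlinarith
  exact inv_le_one_of_one_le₀ h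

/-- **Divergence of a tensor field** `G : 𝕋³ → ℝ^{3×3}` (rows indexed first, tensors in the Pi type
`Fin 3 → Fin 3 → ℝ`): the vector field `(div G)_i = Σ_j ∂_j G_{ij}`, with the tree's pointwise
torus derivative `Torus.partialDeriv` (the operator `div` of "`-ℙ div F⁽ⁱ⁾`" in (4.1); for the
symmetric tensors of the paper the row/column convention is immaterial).
[cite: CoiculescuPalasek2025, §4.1 eq. (4.1) and §2.1 (notation)] -/
def matrixDiv (G : UnitAddTorus (Fin 3) → (Fin 3 → Fin 3 → ℝ)) (x : UnitAddTorus (Fin 3)) :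
    EuclideanSpace ℝ (Fin 3) :=
  WithLp.toLp 2 fun i => ∑ j, Torus.partialDeriv j (fun y => G y i j) x

/-- Coordinates of the tensor divergence: `(div G)(x)_i = Σ_j ∂_j G_{ij}(x)`. [folklore] -/
@[simp]
theorem matrixDiv_apply (G : UnitAddTorus (Fin 3) → (Fin 3 → Fin 3 → ℝ)) (x : UnitAddTorus (Fin 3))
    (i : Fin 3) :
    matrixDiv G x i = ∑ j, Torus.partialDeriv j (fun y => G y i j) x := rfl

/-- **What Prop. 3.13, eq. (4.1) and Prop. 4.1 of Coiculescu–Palasek 2025 assert of one principal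
part `v = v⁽ⁱ⁾` and its residual `F = F⁽ⁱ⁾`** — the complete list of inputs the printed proofs of
Props. 4.2–4.3 draw on — transported to `(0, T] × (ℝ/ℤ)³` (used with `T = unitTime`), with
subcriticality exponent `α`, Hölder exponent `κ`, constants `K m` (of (3.13a), one per number of
derivatives `m`) and `C` (of (3.13b)), lacunarity slope `η` (the paper's `(log A)⁻¹`) and residual
size `ε₀`:
* `solution`: `v`, `π` are jointly smooth on `(0,T] × 𝕋³`, `div v = 0`, and
  `∂ₜv + (v·∇)v = Δv - ∇π - div F` — the classical form of (4.1),
  `-ℙ div F = ∂ₜv - Δv + ℙ div v ⊗ v` (§4.1; Prop. 3.13: "`v⁽¹⁾` and `v⁽²⁾` are divergence-free";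
  §5: "`v⁽ⁱ⁾ ∈ C^∞((0,1] × 𝕋³)`"; see the module docstring for the equivalence and the pressure);
* `smooth_residual`, `residual_symm`: `F ∈ C^∞((0,1] × 𝕋³; S^{3×3})` (Prop. 4.1);
* `hasZeroMean`: `∫ v(t) = 0` (Def. 3.10 with Rmk. 3.11: every constituent `v_k = curl curl ψ_k`,
  `v̄_k = ℙ div(…)` is a derivative);
* `deriv_le`: (3.13a) `‖∇^m v(t)‖_{L^∞} ≲_m t^{-(m+1)/2}` for all `m ≥ 0`, `t ∈ (0,T]` (Prop. 3.13;
  the factor `e^{-N₀²t/O_m(1)} ≤ 1` dropped);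
* `lacunary_le`: (3.13b) `‖v‖²_{L²([t₁,t₂];L^∞)} + ‖v‖_{L¹([t₁,t₂], t^{-1/2}dt; L^∞)} ≲ 1 + (log A)⁻¹ log(t₂/t₁)`
  for `0 < t₁ ≤ t₂ ≤ T` (Prop. 3.13), with constant `C` and slope `η`;
* `residual_le`: `sup_{t ∈ (0,T]} (t^{1-α}‖F(t)‖_{L^∞} + t^{3/2-α}‖∇F(t)‖_{C^κ}) ≤ ε₀`, i.e.
  `‖F‖_Y ≤ ε₀` (Prop. 4.1 with the norm of `Y`, §4.2).
Norm conventions (lifted sup norms of `iteratedFDeriv`, Mathlib's homogeneous `eHolderNorm`) are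
explained in the module docstring. [cite: CoiculescuPalasek2025, Prop. 3.13, §4.1 eq. (4.1), Prop. 4.1, §4.2 (space Y)] -/
structure IsApproximateSolution (T α : ℝ) (κ : ℝ≥0) (K : ℕ → ℝ) (C η ε₀ : ℝ)
    (v : ℝ → UnitAddTorus (Fin 3) → EuclideanSpace ℝ (Fin 3))
    (F : ℝ → UnitAddTorus (Fin 3) → (Fin 3 → Fin 3 → ℝ)) (π : ℝ → UnitAddTorus (Fin 3) → ℝ) :
    Prop where
  /-- (4.1) in classical form: `(v, π)` is a smooth solution of Navier–Stokes (`ν = 1`) on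
  `(0,T] × 𝕋³` with force `-div F`; includes joint smoothness of `v`, `π` and `div v = 0`. -/
  solution : Torus.IsClassicalNSSolutionOn (Ioc 0 T) 1 (fun t x => -matrixDiv (F t) x) v π
  /-- `F` is jointly smooth on `(0,T] × 𝕋³` (Prop. 4.1). -/
  smooth_residual : Torus.IsSmoothSpaceTimeOn (Ioc 0 T) F
  /-- `F` takes values in symmetric tensors (Prop. 4.1: `S^{3×3}`). -/
  residual_symm : ∀ t ∈ Ioc 0 T, ∀ x, ∀ i j : Fin 3, F t x i j = F t x j i
  /-- `v(t)` has zero average on `𝕋³` (Def. 3.10, Rmk. 3.11). -/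
  hasZeroMean : ∀ t ∈ Ioc 0 T, Torus.HasZeroMean (v t)
  /-- (3.13a): `‖∇^m v(t)‖_{L^∞} ≤ K_m t^{-(m+1)/2}` for all `m` and `t ∈ (0,T]`. -/
  deriv_le : ∀ m : ℕ, ∀ t ∈ Ioc 0 T,
    eSupNorm (iteratedFDeriv ℝ m (Torus.lift (v t))) ≤
      ENNReal.ofReal (K m * t ^ (-((m : ℝ) + 1) / 2))
  /-- (3.13b): `∫_{t₁}^{t₂} (‖v(s)‖²_∞ + s^{-1/2}‖v(s)‖_∞) ds ≤ C (1 + η log(t₂/t₁))`,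
  `0 < t₁ ≤ t₂ ≤ T`. -/
  lacunary_le : ∀ t₁ t₂ : ℝ, 0 < t₁ → t₁ ≤ t₂ → t₂ ≤ T →
    ∫ s in t₁..t₂, ((eSupNorm (v s)).toReal ^ 2 + s ^ (-(1 / 2 : ℝ)) * (eSupNorm (v s)).toReal) ≤
      C * (1 + η * Real.log (t₂ / t₁))
  /-- Prop. 4.1: `t^{1-α}‖F(t)‖_{L^∞} + t^{3/2-α}‖∇F(t)‖_{C^κ} ≤ ε₀` for `t ∈ (0,T]`
  (`‖F‖_Y ≤ ε₀`). -/
  residual_le : ∀ t ∈ Ioc 0 T,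
    ENNReal.ofReal (t ^ (1 - α)) * eSupNorm (F t) +
        ENNReal.ofReal (t ^ (3 / 2 - α)) *
          eHolderNorm κ (iteratedFDeriv ℝ 1 (Torus.lift (F t))) ≤
      ENNReal.ofReal ε₀

/-- **(3.13a) with `m = 0`, pointwise:** an approximate solution obeys the Koch–Tataru-type bound
`√t ‖v(t,x)‖ ≤ |K₀|` on `(0,T] × 𝕋³` (`‖v(t,x)‖ = ‖D⁰(lift v(t))(y)‖ ≤ ‖D⁰(lift v(t))‖_∞ ≤ K₀ t^{-1/2}`
for a lift `y` of `x`). [cite: CoiculescuPalasek2025, Prop. 3.13 (3.13a), m = 0] -/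
theorem IsApproximateSolution.sqrt_mul_norm_le {T α : ℝ} {κ : ℝ≥0} {K : ℕ → ℝ} {C η ε₀ : ℝ}
    {v : ℝ → UnitAddTorus (Fin 3) → EuclideanSpace ℝ (Fin 3)}
    {F : ℝ → UnitAddTorus (Fin 3) → (Fin 3 → Fin 3 → ℝ)} {π : ℝ → UnitAddTorus (Fin 3) → ℝ}
    (h : IsApproximateSolution T α κ K C η ε₀ v F π) {t : ℝ}
    (ht : t ∈ Ioc 0 T) (x : UnitAddTorus (Fin 3)) :
    Real.sqrt t * ‖v t x‖ ≤ |K 0| := by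
  have h0 := h.deriv_le 0 t ht
  obtain ⟨y, rfl⟩ := Torus.proj_surjective x
  have hK : K 0 * t ^ (-(((0 : ℕ) : ℝ) + 1) / 2) ≤ |K 0| * t ^ (-(1 / 2 : ℝ)) := by
    have he : (-(((0 : ℕ) : ℝ) + 1) / 2) = -(1 / 2 : ℝ) := by norm_num
    rw [he]
    exact mul_le_mul_of_nonneg_right (le_abs_self _) (Real.rpow_nonneg ht.1.le _)
  have h1 : ‖v t (Torus.proj y)‖ ≤ |K 0| * t ^ (-(1 / 2 : ℝ)) := by
    have h2 : ‖iteratedFDeriv ℝ 0 (Torus.lift (v t)) y‖ₑ ≤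
        ENNReal.ofReal (|K 0| * t ^ (-(1 / 2 : ℝ))) :=
      (enorm_le_eSupNorm _ y).trans (h0.trans (ENNReal.ofReal_le_ofReal hK))
    rw [← ofReal_norm, norm_iteratedFDeriv_zero, Torus.lift_apply] at h2
    exact (ENNReal.ofReal_le_ofReal_iff
      (mul_nonneg (abs_nonneg _) (Real.rpow_nonneg ht.1.le _))).1 h2
  calc Real.sqrt t * ‖v t (Torus.proj y)‖
      ≤ Real.sqrt t * (|K 0| * t ^ (-(1 / 2 : ℝ))) := by gcongr
    _ = |K 0| := by
        rw [Real.sqrt_eq_rpow, Real.rpow_neg ht.1.le, mul_comm, mul_assoc,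
          inv_mul_cancel₀ (Real.rpow_pos_of_pos ht.1 _).ne', mul_one]

/-- The principal part of an approximate solution has continuous time slices on `(0,T]`.
[folklore] -/
theorem IsApproximateSolution.continuous_slice {T α : ℝ} {κ : ℝ≥0} {K : ℕ → ℝ} {C η ε₀ : ℝ}
    {v : ℝ → UnitAddTorus (Fin 3) → EuclideanSpace ℝ (Fin 3)}
    {F : ℝ → UnitAddTorus (Fin 3) → (Fin 3 → Fin 3 → ℝ)} {π : ℝ → UnitAddTorus (Fin 3) → ℝ}
    (h : IsApproximateSolution T α κ K C η ε₀ v F π) {t : ℝ}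
    (ht : t ∈ Ioc 0 T) :
    Continuous (v t) :=
  (h.solution.smooth_velocity.isSmooth_slice ht).continuous

end CoiculescuPalasek2025

open CoiculescuPalasek2025

/-! ## The perturbation theorem (Props. 4.2–4.3) as first rendered — a DEPRECATED record,
refuted as stated

Verdict clean-up 2026-08-16 (RETIRE-REFUTED). The closed `def … : Prop` below was vendored on
2026-08-15 as a named fact and read as literature debt. It is FALSE as stated —
`Literature.Barriers.NavierStokesRegularity.not_CoiculescuPalasek2025_perturbation`
(`CriticalDataSmoothNonuniquenessPerturbationRefuted.lean`, which imports this file) proves its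
negation — so no `…_holds` can exist and it is retired from the debt. It is not deleted: the
refutation theorem must name the statement it refutes, and the first assembly
(`CoiculescuPalasek2025_construction_of_parts`, `…Assembly`) names it too; it is `@[deprecated]`
(string form: the replacements are declared in files importing this one) and nothing new may
take `(h : CoiculescuPalasek2025_perturbation)` as a hypothesis. Replacements: the PROVED reduced
step `CoiculescuPalasek2025_perturbation_reduced` (`…PerturbationReduced`) and the corrected
(`κ ≤ α` / threshold) statement carried as the explicit hypothesis `hB` of
`CoiculescuPalasek2025_construction_of_parts'` (`…CorrectedAssembly`),
`CoiculescuPalasek2025_construction_of_parts_of_threshold` (`…ThresholdAssembly`). -/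

/-- **DEPRECATED RECORD — refuted as stated (verdict clean-up 2026-08-16); do not use.**
Refuted in the tree by `Literature.Barriers.NavierStokesRegularity.not_CoiculescuPalasek2025_perturbation`
(forced one-mode shear flow, `α = 1/16`, `κ = 1/5`: the statement quantifies over every Hölder
exponent `κ ∈ (0, 1/2 - 4α)` and keeps the `Ċ^{1,κ}` slot of `‖w‖_X ≤ ε₁`, while the printed proof
of Prop. 4.2 bounds the gradient of the semigroup with the weight `t^{-(1+κ)/2}` only — arXiv
version p. 19, `h(t) = (t-t')^{1/2}t^{(1+κ)/2}‖∇S(t,t')‖_{C^κ}` — so that Prop. 4.3 closes in `X` iff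
`κ ≤ α`; see the correction section at the end of this file). Retired from the named-fact debt,
kept byte-for-byte because the refutation and the first assembly name it. USE INSTEAD: the proved
reduced step `CoiculescuPalasek2025_perturbation_reduced` (`…PerturbationReduced`; every `κ`, the
five conclusions §5 consumes), or the corrected statement with `κ ≤ α` / `κ` below a threshold,
carried as the explicit hypothesis `hB` of `CoiculescuPalasek2025_construction_of_parts'`
(`…CorrectedAssembly`) and `CoiculescuPalasek2025_construction_of_parts_of_threshold`
(`…ThresholdAssembly`). *Content (unchanged), as first rendered:*
**Coiculescu–Palasek 2025, the perturbation theorem** (Props. 4.2–4.3 with App. B and the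
first paragraph of §5; transported to `(0, T_*] × (ℝ/ℤ)³`). For all `α ∈ (0, 1/8)`,
`κ ∈ (0, 1/2 - 4α)` and constants `K`, `C` there is `C₄ > 0` such that for every
`ε₁ ∈ (0, C₄⁻¹)` there are `ε₀ > 0` and `η > 0` (Prop. 4.3: "There exists `C₄ > 0` such that for
all `ε₁ ∈ (0, C₄⁻¹)` and sufficiently large `A > 1` …"; in the proof `ε₀` is "arranged via
Proposition 4.1" to be small depending on `ε₁`, and `A` large makes the slope `(log A)⁻¹` of
(3.13b) small, Prop. 4.2) with the following property. Whenever `(v, F, π)` is an approximate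
solution on `(0, T_*]` with data `(α, κ, K, C, η, ε₀)` (`CoiculescuPalasek2025.IsApproximateSolution`),
there are a correction `w` and a pressure `q` such that
* `(v + w, q)` is a classical (smooth) solution of the unforced Navier–Stokes equations (`ν = 1`)
  on `(0, T_*] × 𝕋³` (Prop. 4.3: "`u = v + w` … satisfy (NSE)"; §5: "By standard regularity
  theory, `u⁽ⁱ⁾` is in fact smooth on `(0,1] × 𝕋³`"; smooth solutions on the torus have smooth
  pressures);
* `w(t)` has zero mean (the Duhamel formula
  `w(t) = ∫₀ᵗ e^{(t-t')Δ} ℙ div(-2v ⊙ w - w ⊗ w + F)(t') dt'` displayed in the proof of Prop. 4.3: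
  heat flows of divergences are mean-free);
* `w ∈ B_X(0, ε₁)` for the norm `‖V‖_X = sup_{t} (t^{1/2-α/2}‖V‖_{L^∞} + t^{1-α/2}‖∇V‖_{C^κ})` of §4.3,
  slot by slot: `t^{(1-α)/2}‖w(t,x)‖ ≤ ε₁` for all `(t,x)`, and `t^{1-α/2}‖∇w(t)‖_{C^κ} ≤ ε₁`;
* "`w⁽ⁱ⁾(t) → 0` in `𝒞^{-1+α/2}` as `t → 0`" (Prop. 4.3), rendered as `‖w(t)‖_{Ḣ^{-1}} → 0` and
  `∫⟪w(t), φ⟫ → 0` for smooth mean-zero `φ` (both implied: `𝒞^{-1+α/2}(𝕋³) ⊂ Ḣ^{-1}(𝕋³)`, duality).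
WHY THESE HYPOTHESES ARE THE PRINTED ONES. The proof of Prop. 4.2 (semigroup bounds
`‖S(t,t')a‖_{L^∞} + (t-t')^{1/2}‖∇S(t,t')a‖_{C^κ} ≲ (t')^{-1+α-ε} t^{-1/2+ε}‖a‖_Y`) uses: the Duhamel
formula and the heat estimates of Lemma 2.2 / eq. (2.5); "(vweightedlinftybound)" = (3.13a) with
`m = 0` for the terms `II`, `III`; Lemma B.3 (fractional Grönwall, from Lemma B.2) whose exponent
`O(‖v‖_{L¹([t',t],t^{-1/2}dt;L^∞)} + ‖s^{1/2}v‖_{L^∞}‖v‖²_{L²([t',t];L^∞)})` is bounded "By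
(3.13a)–(3.13b)" by `O(1 + (log A)⁻¹ log(t/t'))`, the loss `(t/t')^{O(1/log A)}` being made
`≤ (t/t')^{ε/2}` by "choosing `A` sufficiently large" — i.e. the slope `η` small; for the `C^{1,κ}`
half additionally the algebra property of `C^{1,κ} ∩ L^∞` and `‖∇v(s)‖_{C^κ} ≲ s^{-1-κ/2}` ((3.13a),
`m = 1, 2`). The semigroup exists and is smooth by App. B, Prop. B.1, which needs
`v ∈ C^∞([t',1] × 𝕋³)` divergence-free. The proof of Prop. 4.3 uses Prop. 4.1 only through
(4.1) and `‖F‖_Y ≤ ε₀`, Prop. 4.2, `‖w ⊗ w‖_Y ≲ ‖w‖²_X`, the Banach fixed point theorem in `B_X(0,ε₁)`,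
and, for `w(t) → 0`, eq. (2.5), (3.13a), Prop. 4.1 and interpolation. Nothing else about
`v⁽ⁱ⁾, F⁽ⁱ⁾` enters; the paper notes the abstraction before Prop. 4.2 (quoted in the module
docstring). All constants may depend on `α, κ, K, C` (and the transport), whence the quantifier
order. WHAT THIS ACCOUNT MISSED (2026-08-15/16): the `Ċ^{1,κ}` half of Prop. 4.2 is proved with the
weight `t^{-(1+κ)/2}` (the function `h` of its second Grönwall step), not `t^{-1/2+ε}`, and the
`X`-weight `t^{1-α/2}` of Prop. 4.3 absorbs it only when `κ ≤ α`; in print `κ` is free (§2.4,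
§4.1) and may be taken `≤ α`, here it is universally quantified — hence the refutation.
[cite: CoiculescuPalasek2025, Props. 4.2–4.3, App. B (Prop. B.1, Lemmas B.2–B.3), §5 (first paragraph) — over-generalised first rendering (all κ < 1/2 - 4α), REFUTED in tree by not_CoiculescuPalasek2025_perturbation; proved reduced form CoiculescuPalasek2025_perturbation_reduced; corrected κ ≤ α form = hypothesis hB of CoiculescuPalasek2025_construction_of_parts'] -/
@[deprecated "REFUTED as stated — retired from the named-fact debt (verdict clean-up 2026-08-16): see Literature.Barriers.NavierStokesRegularity.not_CoiculescuPalasek2025_perturbation (CriticalDataSmoothNonuniquenessPerturbationRefuted.lean; the printed proof of Prop. 4.2 supports the C^{1,κ} slot only for κ ≤ α). Use the PROVED reduced step Literature.Barriers.NavierStokesRegularity.CoiculescuPalasek2025_perturbation_reduced (CriticalDataSmoothNonuniquenessPerturbationReduced.lean), or carry the corrected statement (extra hypothesis κ ≤ α) explicitly as CoiculescuPalasek2025_construction_of_parts' (CriticalDataSmoothNonuniquenessCorrectedAssembly.lean) / CoiculescuPalasek2025_construction_of_parts_of_threshold (CriticalDataSmoothNonuniquenessThresholdAssembly.lean) do"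 (since := "2026-08-16")]
def CoiculescuPalasek2025_perturbation : Prop :=
  ∀ α : ℝ, 0 < α → α < 1 / 8 →
  ∀ κ : ℝ≥0, 0 < κ → (κ : ℝ) < 1 / 2 - 4 * α →
  ∀ (K : ℕ → ℝ) (C : ℝ),
  ∃ C₄ : ℝ, 0 < C₄ ∧
  ∀ ε₁ : ℝ, 0 < ε₁ → ε₁ < C₄⁻¹ →
  ∃ ε₀ : ℝ, 0 < ε₀ ∧ ∃ η : ℝ, 0 < η ∧
  ∀ (v : ℝ → UnitAddTorus (Fin 3) → EuclideanSpace ℝ (Fin 3))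
    (F : ℝ → UnitAddTorus (Fin 3) → (Fin 3 → Fin 3 → ℝ)) (π : ℝ → UnitAddTorus (Fin 3) → ℝ),
    IsApproximateSolution unitTime α κ K C η ε₀ v F π →
    ∃ (w : ℝ → UnitAddTorus (Fin 3) → EuclideanSpace ℝ (Fin 3)) (q : ℝ → UnitAddTorus (Fin 3) → ℝ),
      Torus.IsClassicalNSSolutionOn (Ioc 0 unitTime) 1 0 (v + w) q ∧
      (∀ t ∈ Ioc (0 : ℝ) unitTime, Torus.HasZeroMean (w t)) ∧
      (∀ t ∈ Ioc (0 : ℝ) unitTime, ∀ x, t ^ ((1 - α) / 2) * ‖w t x‖ ≤ ε₁) ∧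
      (∀ t ∈ Ioc (0 : ℝ) unitTime,
        ENNReal.ofReal (t ^ (1 - α / 2)) *
            eHolderNorm κ (iteratedFDeriv ℝ 1 (Torus.lift (w t))) ≤
          ENNReal.ofReal ε₁) ∧
      Tendsto (fun t => Torus.eHomSobolevSeminorm (-1) (EuclideanSpace.complexify ∘ w t))
        (𝓝[>] 0) (𝓝 0) ∧
      ∀ φ : UnitAddTorus (Fin 3) → EuclideanSpace ℝ (Fin 3), Torus.IsSmooth φ →
        Torus.HasZeroMean φ → Tendsto (fun t => ∫ x, ⟪w t x, φ x⟫) (𝓝[>] 0) (𝓝 0)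

/-! ## The assembly (§5) — first version, over the deprecated record (deprecated with it)

The theorem below is KEPT verbatim (statement and proof unchanged: `…Assembly` applies it) but is
deprecated together with its hypothesis `hB = CoiculescuPalasek2025_perturbation`, which is refuted,
so that the implication is vacuous. The same §5 argument over the sound seam is
`CoiculescuPalasek2025.construction_of_parts_at` / `CoiculescuPalasek2025_construction_of_parts_of_threshold`
(`…ThresholdAssembly`) and `CoiculescuPalasek2025_construction_of_parts'` (`…CorrectedAssembly`);
with the reduced step proved, the barrier follows from the principal parts alone
(`CriticalDataSmoothNonuniqueness_of_principalParts`, `…PerturbationReduced`). -/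

-- names the `@[deprecated]` record `CoiculescuPalasek2025_perturbation` on purpose: this is the
-- first assembly over that record, kept only because `…Assembly` applies it (verdict clean-up
-- 2026-08-16); REMOVE-WHEN `CriticalDataSmoothNonuniqueness_of_principalParts_of_perturbation`
-- (`…Assembly`) is deleted — then delete this theorem as well.
set_option linter.deprecated false in
/-- **DEPRECATED (2026-08-16) — vacuous: hypothesis `hB` is the refuted record
`CoiculescuPalasek2025_perturbation`; use `CoiculescuPalasek2025.construction_of_parts_at` /
`CoiculescuPalasek2025_construction_of_parts_of_threshold` (`…ThresholdAssembly`) or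
`CoiculescuPalasek2025_construction_of_parts'` (`…CorrectedAssembly`), whose proofs are this one
run at the decreased exponent `min κ κ₁`.** *Content (unchanged):*
**§5 of Coiculescu–Palasek 2025 below the seam, proved**: the principal parts with their
residuals (hypothesis `hA`, explicit) and the perturbation theorem
(`CoiculescuPalasek2025_perturbation`) imply the finite-time construction — for every `ε > 0`:
some `T > 0` (here `T = T_*`) and two classical solutions of the unforced equations on
`(0,T] × 𝕋³` obeying `√t‖·(t)‖_∞ ≤ M`, distinct at some `t₀ ∈ (0,T]`, with a common datum in the
`Ḣ^{-1}`/pairing sense, mean zero and of sup norm `≤ ε` at `t = T` (stated explicitly; literally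
the hypothesis `h₁` of `CriticalDataSmoothNonuniqueness_of_parts`, whose docstring carries the
clause-by-clause citations of the conclusion).

Hypothesis `hA` is **Coiculescu–Palasek 2025, the principal parts and their residuals**
(Def. 3.10, Prop. 3.13, Prop. 4.1 and the `v`-only estimates of §5; transported to
`(0, T_*] × (ℝ/ℤ)³`, `T_* = unitTime`), stated explicitly — it is the remaining proof obligation
of the barrier fact, not a named fact (D-0026; the whole of §3 with §4.1 of the paper, SIZE XL;
see the module docstring). It reads: for every subcriticality exponent `α ∈ (0, 1/8)` (§2.4,
§4.1) there are a Hölder exponent `κ`, `0 < κ < 1/2 - 4α` (§4.1: `κ ∈ (0, 1/2 - 1/(2γ) - 2α)` with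
the admissible `b, γ` of §2.4, all of which obey `1/(2γ) > 2α + 1/(2b)`), and constants
`K : ℕ → ℝ`, `C : ℝ` (the implicit constants of Prop. 3.13, which "may depend on
`α, β, γ, δ, δ₀, ε, κ, b,` and `c₁` but not `A`", §2.4) such that for all targets `ε₀, η, δ > 0` and
`L ∈ ℝ` — each met in print by taking the scale parameter `A` large (§2.4) — there exist two
triples `(v₁, F₁, π₁)`, `(v₂, F₂, π₂)` (in print: `v⁽¹⁾ = Σ_{k even} v_k + Σ_{k odd} v̄_k`,
`v⁽²⁾ = Σ_{k odd} v_k + Σ_{k even} v̄_k`, Def. 3.10; the residuals `F⁽¹⁾, F⁽²⁾` fixed in the proof of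
Prop. 4.1; the pressures of the classical form of (4.1)) such that:
* each is an approximate solution in the sense of `CoiculescuPalasek2025.IsApproximateSolution`
  on `(0, T_*]` with data `(α, κ, K, C, η, ε₀)` — Prop. 3.13 ((3.13a) for all `m`, (3.13b) with
  slope `(log A)⁻¹ ≤ η`), eq. (4.1), Prop. 4.1 ("for any `ε₀ > 0` and all sufficiently large `A` …
  `sup_{t∈(0,1]} (t^{1-α}‖F⁽ⁱ⁾‖_{L^∞} + t^{3/2-α}‖∇F⁽ⁱ⁾‖_{C^κ}) ≤ ε₀`"), zero mean (Rmk. 3.11);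
* DISTINCTNESS WITH MARGIN (§5, "Finally, we show that the two solutions are distinct"): at some
  `t₀ ∈ (0, T_*]` (in print `t₀ = N₀⁻²`) and some point `x₀`,
  `t₀^{(1-α)/2} ‖v₁(t₀,x₀) - v₂(t₀,x₀)‖ ≥ L` — in print
  `‖v⁽¹⁾(t₀) - v⁽²⁾(t₀)‖_{L^∞} ≥ ‖v₀(t₀)‖_∞ - Σ_{k≥1}‖v_k(t₀)‖_∞ - Σ_{k≥0}‖v̄_k(t₀)‖_∞ ≥ (C₅⁻¹ - O(A^{-c}))N₀`,
  which exceeds `L t₀^{-(1-α)/2} = L N₀^{1-α}` once `A` (hence `N₀`) is large;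
* COMMON DATUM (§5, second and third paragraphs: `v⁽ⁱ⁾(t) → U⁰` in `Ẇ^{-1,p}(𝕋³)` for all
  `1 < p < ∞`, both `i`), rendered for `p = 2` over `Torus.eHomSobolevSeminorm (-1)` as in the
  sibling facts: `‖v₁(t) - v₂(t)‖_{Ḣ^{-1}} → 0`, each `vᵢ(t)` Cauchy in `Ḣ^{-1}` as `t → 0⁺`, and for
  every smooth mean-zero test field `φ` the pairings `∫⟪v₁(t), φ⟫`, `∫⟪v₂(t), φ⟫` converge to a
  common limit (`= ⟨U⁰, φ⟩`);
* SMALLNESS AT THE FINAL TIME (§5, last paragraph: "`‖∇^m v⁽ⁱ⁾|_{t=1}‖_{L^∞} ≤ exp(-N₀²/O_m(1))`",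
  `m = 0`): `‖vᵢ(T_*, x)‖ ≤ δ` for all `x`.
See the module docstring for the transport and the rendering conventions.

Proof (the Lean content of the rest of §5). With `α = 1/16`: take `κ, K, C` from `hA` and `C₄`
from the perturbation fact; given `ε > 0` put `ε₁ = min (C₄⁻¹/2) (ε/2 · T_*^{(1-α)/2})`, take
`ε₀, η`, run `hA` with margin `L = 3ε₁` and final smallness `ε/2`, and perturb both parts. The
clauses of the target: classical solutions `uᵢ = vᵢ + wᵢ` (perturbation fact); Koch–Tataru bound
with `M = |K 0| + ε₁` (`sqrt_mul_norm_le` and `√t · ‖w‖ = t^{α/2} · t^{(1-α)/2}‖w‖ ≤ ε₁`,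
`t ≤ T_* ≤ 1`); distinct at `t₀` (were `u₁(t₀) = u₂(t₀)`, then
`3ε₁ ≤ t₀^{(1-α)/2}‖v₁ - v₂‖(t₀,x₀) ≤ t₀^{(1-α)/2}(‖w₁‖ + ‖w₂‖)(t₀,x₀) ≤ 2ε₁`); the `Ḣ^{-1}` clauses
by the triangle inequality `eHomSobolevSeminorm_complexify_add_le/sub_le` and squeezing; the
pairings by additivity of the integral; zero mean by additivity; `‖uᵢ(T_*)‖ ≤ ε/2 + ε/2`.
[cite: CoiculescuPalasek2025, Def. 3.10, Prop. 3.13, Prop. 4.1 and §5 (proof of Thm. 1.2)] -/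
@[deprecated "vacuous since 2026-08-16: its hypothesis hB = CoiculescuPalasek2025_perturbation is refuted (not_CoiculescuPalasek2025_perturbation). Use Literature.Barriers.NavierStokesRegularity.CoiculescuPalasek2025.construction_of_parts_at / CoiculescuPalasek2025_construction_of_parts_of_threshold (CriticalDataSmoothNonuniquenessThresholdAssembly.lean) or CoiculescuPalasek2025_construction_of_parts' (CriticalDataSmoothNonuniquenessCorrectedAssembly.lean); the barrier from the principal parts alone is CriticalDataSmoothNonuniqueness_of_principalParts (CriticalDataSmoothNonuniquenessPerturbationReduced.lean)" (since := "2026-08-16")]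
theorem CoiculescuPalasek2025_construction_of_parts
    (hA : ∀ α : ℝ, 0 < α → α < 1 / 8 →
      ∃ κ : ℝ≥0, 0 < κ ∧ (κ : ℝ) < 1 / 2 - 4 * α ∧
      ∃ (K : ℕ → ℝ) (C : ℝ),
      ∀ (ε₀ η L δ : ℝ), 0 < ε₀ → 0 < η → 0 < δ →
      ∃ (v₁ v₂ : ℝ → UnitAddTorus (Fin 3) → EuclideanSpace ℝ (Fin 3))
        (F₁ F₂ : ℝ → UnitAddTorus (Fin 3) → (Fin 3 → Fin 3 → ℝ))
        (π₁ π₂ : ℝ → UnitAddTorus (Fin 3) → ℝ),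
        IsApproximateSolution unitTime α κ K C η ε₀ v₁ F₁ π₁ ∧
        IsApproximateSolution unitTime α κ K C η ε₀ v₂ F₂ π₂ ∧
        (∃ t₀ ∈ Ioc (0 : ℝ) unitTime, ∃ x₀ : UnitAddTorus (Fin 3),
          L ≤ t₀ ^ ((1 - α) / 2) * ‖v₁ t₀ x₀ - v₂ t₀ x₀‖) ∧
        Tendsto (fun t =>
            Torus.eHomSobolevSeminorm (-1) (EuclideanSpace.complexify ∘ (v₁ t - v₂ t)))
          (𝓝[>] 0) (𝓝 0) ∧
        Tendsto (fun st : ℝ × ℝ =>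
            Torus.eHomSobolevSeminorm (-1) (EuclideanSpace.complexify ∘ (v₁ st.1 - v₁ st.2)))
          ((𝓝[>] (0 : ℝ)) ×ˢ (𝓝[>] (0 : ℝ))) (𝓝 0) ∧
        Tendsto (fun st : ℝ × ℝ =>
            Torus.eHomSobolevSeminorm (-1) (EuclideanSpace.complexify ∘ (v₂ st.1 - v₂ st.2)))
          ((𝓝[>] (0 : ℝ)) ×ˢ (𝓝[>] (0 : ℝ))) (𝓝 0) ∧
        (∀ φ : UnitAddTorus (Fin 3) → EuclideanSpace ℝ (Fin 3), Torus.IsSmooth φ →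
          Torus.HasZeroMean φ →
          ∃ c : ℝ, Tendsto (fun t => ∫ x, ⟪v₁ t x, φ x⟫) (𝓝[>] 0) (𝓝 c) ∧
            Tendsto (fun t => ∫ x, ⟪v₂ t x, φ x⟫) (𝓝[>] 0) (𝓝 c)) ∧
        (∀ x, ‖v₁ unitTime x‖ ≤ δ ∧ ‖v₂ unitTime x‖ ≤ δ))
    (hB : CoiculescuPalasek2025_perturbation) :
    ∀ ε : ℝ, 0 < ε →
      ∃ T : ℝ, 0 < T ∧
      ∃ (u v : ℝ → UnitAddTorus (Fin 3) → EuclideanSpace ℝ (Fin 3))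
        (p₁ p₂ : ℝ → UnitAddTorus (Fin 3) → ℝ),
        Torus.IsClassicalNSSolutionOn (Ioc 0 T) 1 0 u p₁ ∧
        Torus.IsClassicalNSSolutionOn (Ioc 0 T) 1 0 v p₂ ∧
        (∃ M : ℝ, ∀ t ∈ Ioc (0 : ℝ) T, ∀ x,
          Real.sqrt t * ‖u t x‖ ≤ M ∧ Real.sqrt t * ‖v t x‖ ≤ M) ∧
        (∃ t₀ ∈ Ioc (0 : ℝ) T, u t₀ ≠ v t₀) ∧
        Tendsto (fun t =>
            Torus.eHomSobolevSeminorm (-1) (EuclideanSpace.complexify ∘ (u t - v t)))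
          (𝓝[>] 0) (𝓝 0) ∧
        Tendsto (fun st : ℝ × ℝ =>
            Torus.eHomSobolevSeminorm (-1) (EuclideanSpace.complexify ∘ (u st.1 - u st.2)))
          ((𝓝[>] (0 : ℝ)) ×ˢ (𝓝[>] (0 : ℝ))) (𝓝 0) ∧
        Tendsto (fun st : ℝ × ℝ =>
            Torus.eHomSobolevSeminorm (-1) (EuclideanSpace.complexify ∘ (v st.1 - v st.2)))
          ((𝓝[>] (0 : ℝ)) ×ˢ (𝓝[>] (0 : ℝ))) (𝓝 0) ∧
        (∀ φ : UnitAddTorus (Fin 3) → EuclideanSpace ℝ (Fin 3),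
          Torus.IsSmooth φ → Torus.HasZeroMean φ →
          (∃ c : ℝ, Tendsto (fun t => ∫ x, ⟪u t x, φ x⟫) (𝓝[>] 0) (𝓝 c)) ∧
          (∃ c : ℝ, Tendsto (fun t => ∫ x, ⟪v t x, φ x⟫) (𝓝[>] 0) (𝓝 c)) ∧
          Tendsto (fun t => ∫ x, ⟪u t x - v t x, φ x⟫) (𝓝[>] 0) (𝓝 0)) ∧
        Torus.HasZeroMean (u T) ∧ Torus.HasZeroMean (v T) ∧
        (∀ x, ‖u T x‖ ≤ ε ∧ ‖v T x‖ ≤ ε) := by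
  intro ε hε
  -- parameters: `α = 1/16`, then `κ, K, C` (`hA`), `C₄` (`hB`), `ε₁`, then `ε₀, η` (`hB`)
  have hα : (0 : ℝ) < 1 / 16 := by norm_num
  have hα' : (1 / 16 : ℝ) < 1 / 8 := by norm_num
  obtain ⟨κ, hκ, hκ', K, C, hA⟩ := hA (1 / 16) hα hα'
  obtain ⟨C₄, hC₄, hB⟩ := hB (1 / 16) hα hα' κ hκ hκ' K C
  have hT0 : 0 < unitTime := unitTime_pos
  have hT1 : unitTime ≤ 1 := unitTime_le_one
  have hTmem : unitTime ∈ Ioc (0 : ℝ) unitTime := ⟨hT0, le_rfl⟩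
  obtain ⟨c, hc⟩ : ∃ c : ℝ, c = unitTime ^ ((1 - (1 / 16 : ℝ)) / 2) := ⟨_, rfl⟩
  have hc0 : 0 < c := hc ▸ Real.rpow_pos_of_pos hT0 _
  have hC₄' : 0 < C₄⁻¹ := inv_pos.2 hC₄
  obtain ⟨ε₁, hε₁⟩ : ∃ ε₁ : ℝ, ε₁ = min (C₄⁻¹ / 2) (ε / 2 * c) := ⟨_, rfl⟩
  have hε₁0 : 0 < ε₁ := hε₁ ▸ lt_min (half_pos hC₄') (mul_pos (half_pos hε) hc0)
  have hε₁1 : ε₁ < C₄⁻¹ := hε₁ ▸ (min_le_left _ _).trans_lt (half_lt_self hC₄')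
  have hε₁2 : ε₁ ≤ ε / 2 * c := hε₁ ▸ min_le_right _ _
  obtain ⟨ε₀, hε₀, η, hη, hB⟩ := hB ε₁ hε₁0 hε₁1
  obtain ⟨v₁, v₂, F₁, F₂, π₁, π₂, h₁, h₂, ⟨t₀, ht₀, x₀, hdist⟩, hdat, hc₁, hc₂, hφ, hδ⟩ :=
    hA ε₀ η (3 * ε₁) (ε / 2) hε₀ hη (half_pos hε)
  obtain ⟨w₁, q₁, hu₁, hm₁, hw₁, -, hH₁, hP₁⟩ := hB v₁ F₁ π₁ h₁
  obtain ⟨w₂, q₂, hu₂, hm₂, hw₂, -, hH₂, hP₂⟩ := hB v₂ F₂ π₂ h₂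
  -- continuity of all slices on `(0, T_*]`
  have hv₁c : ∀ t ∈ Ioc (0 : ℝ) unitTime, Continuous (v₁ t) := fun t ht => h₁.continuous_slice ht
  have hv₂c : ∀ t ∈ Ioc (0 : ℝ) unitTime, Continuous (v₂ t) := fun t ht => h₂.continuous_slice ht
  have hw₁c : ∀ t ∈ Ioc (0 : ℝ) unitTime, Continuous (w₁ t) := fun t ht => by
    have h := ((hu₁.smooth_velocity.isSmooth_slice ht).continuous).sub (hv₁c t ht)
    rwa [Pi.add_apply, add_sub_cancel_left] at h
  have hw₂c : ∀ t ∈ Ioc (0 : ℝ) unitTime, Continuous (w₂ t) := fun t ht => by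
    have h := ((hu₂.smooth_velocity.isSmooth_slice ht).continuous).sub (hv₂c t ht)
    rwa [Pi.add_apply, add_sub_cancel_left] at h
  -- the sup-norm slot of `‖wᵢ‖_X ≤ ε₁`, in the two forms used below
  have hwKT : ∀ {w : ℝ → UnitAddTorus (Fin 3) → EuclideanSpace ℝ (Fin 3)},
      (∀ t ∈ Ioc (0 : ℝ) unitTime, ∀ x, t ^ ((1 - (1 / 16 : ℝ)) / 2) * ‖w t x‖ ≤ ε₁) →
      ∀ t ∈ Ioc (0 : ℝ) unitTime, ∀ x, Real.sqrt t * ‖w t x‖ ≤ ε₁ := by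
    intro w hw t ht x
    have hsplit : Real.sqrt t = t ^ ((1 / 16 : ℝ) / 2) * t ^ ((1 - (1 / 16 : ℝ)) / 2) := by
      rw [Real.sqrt_eq_rpow, ← Real.rpow_add ht.1]
      norm_num
    have hle1 : t ^ ((1 / 16 : ℝ) / 2) ≤ 1 :=
      Real.rpow_le_one ht.1.le (ht.2.trans hT1) (by norm_num)
    calc Real.sqrt t * ‖w t x‖
        = t ^ ((1 / 16 : ℝ) / 2) * (t ^ ((1 - (1 / 16 : ℝ)) / 2) * ‖w t x‖) := by
          rw [hsplit, mul_assoc]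
      _ ≤ 1 * ε₁ :=
          mul_le_mul hle1 (hw t ht x) (mul_nonneg (Real.rpow_nonneg ht.1.le _) (norm_nonneg _))
            zero_le_one
      _ = ε₁ := one_mul _
  have hwT : ∀ {w : ℝ → UnitAddTorus (Fin 3) → EuclideanSpace ℝ (Fin 3)},
      (∀ t ∈ Ioc (0 : ℝ) unitTime, ∀ x, t ^ ((1 - (1 / 16 : ℝ)) / 2) * ‖w t x‖ ≤ ε₁) →
      ∀ x, ‖w unitTime x‖ ≤ ε / 2 := by
    intro w hw x
    have h := (hw unitTime hTmem x).trans hε₁2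
    rw [← hc, mul_comm (ε / 2) c] at h
    exact le_of_mul_le_mul_left h hc0
  -- triangle inequality pattern for the `Ḣ^{-1}` clauses
  have tri : ∀ {a b p q : UnitAddTorus (Fin 3) → EuclideanSpace ℝ (Fin 3)},
      Continuous a → Continuous b → Continuous p → Continuous q →
      Torus.eHomSobolevSeminorm (-1) (EuclideanSpace.complexify ∘ (a + p - (b + q))) ≤
        Torus.eHomSobolevSeminorm (-1) (EuclideanSpace.complexify ∘ (a - b)) +
          (Torus.eHomSobolevSeminorm (-1) (EuclideanSpace.complexify ∘ p) +
            Torus.eHomSobolevSeminorm (-1) (EuclideanSpace.complexify ∘ q)) := by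
    intro a b p q ha hb hp hq
    rw [← sub_add_sub_comm]
    exact (eHomSobolevSeminorm_complexify_add_le _ (ha.sub hb) (hp.sub hq)).trans
      (add_le_add le_rfl (eHomSobolevSeminorm_complexify_sub_le _ hp hq))
  -- agreement filters at `0⁺`
  have hI : Ioc (0 : ℝ) unitTime ∈ 𝓝[>] (0 : ℝ) := Ioc_mem_nhdsGT hT0
  have hI2 : ∀ᶠ st in (𝓝[>] (0 : ℝ)) ×ˢ (𝓝[>] (0 : ℝ)),
      st.1 ∈ Ioc (0 : ℝ) unitTime ∧ st.2 ∈ Ioc (0 : ℝ) unitTime :=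
    (eventually_of_mem hI fun t ht => ht).prod_mk (eventually_of_mem hI fun t ht => ht)
  refine ⟨unitTime, hT0, v₁ + w₁, v₂ + w₂, q₁, q₂, hu₁, hu₂, ⟨|K 0| + ε₁, fun t ht x => ?_⟩,
    ⟨t₀, ht₀, fun heq => ?_⟩, ?_, ?_, ?_, fun φ hφs hφm => ?_, ?_, ?_, fun x => ?_⟩
  · -- Koch–Tataru bound on `(0, T_*]`
    simp only [Pi.add_apply]
    constructor
    · calc Real.sqrt t * ‖v₁ t x + w₁ t x‖
          ≤ Real.sqrt t * (‖v₁ t x‖ + ‖w₁ t x‖) := by gcongr; exact norm_add_le _ _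
        _ = Real.sqrt t * ‖v₁ t x‖ + Real.sqrt t * ‖w₁ t x‖ := mul_add _ _ _
        _ ≤ |K 0| + ε₁ := add_le_add (h₁.sqrt_mul_norm_le ht x) (hwKT hw₁ t ht x)
    · calc Real.sqrt t * ‖v₂ t x + w₂ t x‖
          ≤ Real.sqrt t * (‖v₂ t x‖ + ‖w₂ t x‖) := by gcongr; exact norm_add_le _ _
        _ = Real.sqrt t * ‖v₂ t x‖ + Real.sqrt t * ‖w₂ t x‖ := mul_add _ _ _
        _ ≤ |K 0| + ε₁ := add_le_add (h₂.sqrt_mul_norm_le ht x) (hwKT hw₂ t ht x)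
  · -- distinct at `t₀`
    have hx : v₁ t₀ x₀ + w₁ t₀ x₀ = v₂ t₀ x₀ + w₂ t₀ x₀ := by
      simpa only [Pi.add_apply] using congrFun heq x₀
    have hvw : v₁ t₀ x₀ - v₂ t₀ x₀ = w₂ t₀ x₀ - w₁ t₀ x₀ := by
      rw [sub_eq_sub_iff_add_eq_add, hx, add_comm]
    have hn : ‖v₁ t₀ x₀ - v₂ t₀ x₀‖ ≤ ‖w₂ t₀ x₀‖ + ‖w₁ t₀ x₀‖ := by
      rw [hvw]; exact norm_sub_le _ _
    have ht₀c : 0 ≤ t₀ ^ ((1 - (1 / 16 : ℝ)) / 2) := Real.rpow_nonneg ht₀.1.le _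
    have key : 3 * ε₁ ≤ ε₁ + ε₁ :=
      calc 3 * ε₁ ≤ t₀ ^ ((1 - (1 / 16 : ℝ)) / 2) * ‖v₁ t₀ x₀ - v₂ t₀ x₀‖ := hdist
        _ ≤ t₀ ^ ((1 - (1 / 16 : ℝ)) / 2) * (‖w₂ t₀ x₀‖ + ‖w₁ t₀ x₀‖) := by gcongr
        _ = t₀ ^ ((1 - (1 / 16 : ℝ)) / 2) * ‖w₂ t₀ x₀‖ +
              t₀ ^ ((1 - (1 / 16 : ℝ)) / 2) * ‖w₁ t₀ x₀‖ := mul_add _ _ _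
        _ ≤ ε₁ + ε₁ := add_le_add (hw₂ t₀ ht₀ x₀) (hw₁ t₀ ht₀ x₀)
    linarith
  · -- common datum in `Ḣ^{-1}`
    have hlim : Tendsto (fun t =>
        Torus.eHomSobolevSeminorm (-1) (EuclideanSpace.complexify ∘ (v₁ t - v₂ t)) +
          (Torus.eHomSobolevSeminorm (-1) (EuclideanSpace.complexify ∘ w₁ t) +
            Torus.eHomSobolevSeminorm (-1) (EuclideanSpace.complexify ∘ w₂ t)))
        (𝓝[>] 0) (𝓝 0) := by
      simpa using hdat.add (hH₁.add hH₂)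
    refine tendsto_of_tendsto_of_tendsto_of_le_of_le' tendsto_const_nhds hlim
      (Eventually.of_forall fun t => zero_le) ?_
    filter_upwards [hI] with t ht
    simp only [Pi.add_apply]
    exact tri (hv₁c t ht) (hv₂c t ht) (hw₁c t ht) (hw₂c t ht)
  · -- `u₁(t)` Cauchy in `Ḣ^{-1}` as `t → 0⁺`
    have hlim : Tendsto (fun st : ℝ × ℝ =>
        Torus.eHomSobolevSeminorm (-1) (EuclideanSpace.complexify ∘ (v₁ st.1 - v₁ st.2)) +
          (Torus.eHomSobolevSeminorm (-1) (EuclideanSpace.complexify ∘ w₁ st.1) +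
            Torus.eHomSobolevSeminorm (-1) (EuclideanSpace.complexify ∘ w₁ st.2)))
        ((𝓝[>] (0 : ℝ)) ×ˢ (𝓝[>] (0 : ℝ))) (𝓝 0) := by
      simpa [Function.comp_def] using
        hc₁.add ((hH₁.comp tendsto_fst).add (hH₁.comp tendsto_snd))
    refine tendsto_of_tendsto_of_tendsto_of_le_of_le' tendsto_const_nhds hlim
      (Eventually.of_forall fun st => zero_le) ?_
    filter_upwards [hI2] with st hst
    simp only [Pi.add_apply]
    exact tri (hv₁c _ hst.1) (hv₁c _ hst.2) (hw₁c _ hst.1) (hw₁c _ hst.2)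
  · -- `u₂(t)` Cauchy in `Ḣ^{-1}` as `t → 0⁺`
    have hlim : Tendsto (fun st : ℝ × ℝ =>
        Torus.eHomSobolevSeminorm (-1) (EuclideanSpace.complexify ∘ (v₂ st.1 - v₂ st.2)) +
          (Torus.eHomSobolevSeminorm (-1) (EuclideanSpace.complexify ∘ w₂ st.1) +
            Torus.eHomSobolevSeminorm (-1) (EuclideanSpace.complexify ∘ w₂ st.2)))
        ((𝓝[>] (0 : ℝ)) ×ˢ (𝓝[>] (0 : ℝ))) (𝓝 0) := by
      simpa [Function.comp_def] using
        hc₂.add ((hH₂.comp tendsto_fst).add (hH₂.comp tendsto_snd))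
    refine tendsto_of_tendsto_of_tendsto_of_le_of_le' tendsto_const_nhds hlim
      (Eventually.of_forall fun st => zero_le) ?_
    filter_upwards [hI2] with st hst
    simp only [Pi.add_apply]
    exact tri (hv₂c _ hst.1) (hv₂c _ hst.2) (hw₂c _ hst.1) (hw₂c _ hst.2)
  · -- distributional pairings against smooth mean-zero test fields
    obtain ⟨c, hcv₁, hcv₂⟩ := hφ φ hφs hφm
    have hφc : Continuous φ := hφs.continuous
    have hadd : ∀ {v w : ℝ → UnitAddTorus (Fin 3) → EuclideanSpace ℝ (Fin 3)},
        (∀ t ∈ Ioc (0 : ℝ) unitTime, Continuous (v t)) →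
        (∀ t ∈ Ioc (0 : ℝ) unitTime, Continuous (w t)) →
        ∀ t ∈ Ioc (0 : ℝ) unitTime,
          ∫ x, ⟪(v + w) t x, φ x⟫ = (∫ x, ⟪v t x, φ x⟫) + ∫ x, ⟪w t x, φ x⟫ := by
      intro v w hv hw t ht
      simp only [Pi.add_apply, inner_add_left]
      exact integral_add (integrable_inner_of_continuous (hv t ht) hφc)
        (integrable_inner_of_continuous (hw t ht) hφc)
    have hu₁t : Tendsto (fun t => ∫ x, ⟪(v₁ + w₁) t x, φ x⟫) (𝓝[>] 0) (𝓝 c) := by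
      have h := hcv₁.add (hP₁ φ hφs hφm)
      rw [add_zero] at h
      refine h.congr' ?_
      filter_upwards [hI] with t ht
      exact (hadd hv₁c hw₁c t ht).symm
    have hu₂t : Tendsto (fun t => ∫ x, ⟪(v₂ + w₂) t x, φ x⟫) (𝓝[>] 0) (𝓝 c) := by
      have h := hcv₂.add (hP₂ φ hφs hφm)
      rw [add_zero] at h
      refine h.congr' ?_
      filter_upwards [hI] with t ht
      exact (hadd hv₂c hw₂c t ht).symm
    refine ⟨⟨c, hu₁t⟩, ⟨c, hu₂t⟩, ?_⟩
    have h := hu₁t.sub hu₂t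
    rw [sub_self] at h
    refine h.congr' ?_
    filter_upwards [hI] with t ht
    rw [← integral_sub
      (integrable_inner_of_continuous (hu₁.smooth_velocity.isSmooth_slice ht).continuous hφc)
      (integrable_inner_of_continuous (hu₂.smooth_velocity.isSmooth_slice ht).continuous hφc)]
    refine integral_congr_ae (Eventually.of_forall fun x => ?_)
    simp only [inner_sub_left]
  · -- zero mean of `u₁(T_*)`
    show ∫ x, (v₁ + w₁) unitTime x = 0
    simp only [Pi.add_apply]
    rw [integral_add
      ((hv₁c _ hTmem).integrable_of_hasCompactSupport (HasCompactSupport.of_compactSpace _))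
      ((hw₁c _ hTmem).integrable_of_hasCompactSupport (HasCompactSupport.of_compactSpace _))]
    have e1 : ∫ x, v₁ unitTime x = 0 := h₁.hasZeroMean _ hTmem
    have e2 : ∫ x, w₁ unitTime x = 0 := hm₁ _ hTmem
    rw [e1, e2, add_zero]
  · -- zero mean of `u₂(T_*)`
    show ∫ x, (v₂ + w₂) unitTime x = 0
    simp only [Pi.add_apply]
    rw [integral_add
      ((hv₂c _ hTmem).integrable_of_hasCompactSupport (HasCompactSupport.of_compactSpace _))
      ((hw₂c _ hTmem).integrable_of_hasCompactSupport (HasCompactSupport.of_compactSpace _))]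
    have e1 : ∫ x, v₂ unitTime x = 0 := h₂.hasZeroMean _ hTmem
    have e2 : ∫ x, w₂ unitTime x = 0 := hm₂ _ hTmem
    rw [e1, e2, add_zero]
  · -- smallness at `T_*`
    simp only [Pi.add_apply]
    exact ⟨(norm_add_le _ _).trans (by linarith [(hδ x).1, hwT hw₁ x]),
      (norm_add_le _ _).trans (by linarith [(hδ x).2, hwT hw₂ x])⟩

/-! ## Correction (2026-08-15): the perturbation theorem as the printed proof supports it,
`κ ≤ α`

(Outcome, 2026-08-16: the analysis below was confirmed — the record is refuted in the tree,
`not_CoiculescuPalasek2025_perturbation` in `…PerturbationRefuted`, and deprecated above; the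
corrected statement announced here was not minted as a named fact `CoiculescuPalasek2025_perturbation'`
but is carried as the explicit hypothesis `hB` of `CoiculescuPalasek2025_construction_of_parts'`
(`…CorrectedAssembly`) and, in threshold form, of `CoiculescuPalasek2025_construction_of_parts_of_threshold`
(`…ThresholdAssembly`), D-0026; the reduced step without the `Ċ^{1,κ}` slot is proved for every `κ`,
`CoiculescuPalasek2025_perturbation_reduced` in `…PerturbationReduced`. All of them use the exponent
monotonicity proved in this section.)

The record `CoiculescuPalasek2025_perturbation` above quantifies over every Hölder exponent
`κ ∈ (0, 1/2 - 4α)`. The printed proof of Prop. 4.2 does NOT deliver the stated bound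
`(t-t')^{1/2}‖∇S(t,t')a‖_{C^κ} ≲ (t')^{-1+α-ε}t^{-1/2+ε}‖a‖_Y` for the gradient: its three pieces are
bounded by `(t-t')^{-1/2}(t')^{-1+α}(t/2)^{-(1+κ)/2}`, `(t-t')^{-κ/2}(t')^{-1+α-ε/2}t^{-1+ε/2}` and
`(t')^{-1+α-ε/2}t^{-1+ε/2-κ/2}` (times `‖a‖_Y`), and the fractional Grönwall inequality is run for
`h(t) = (t-t')^{1/2} t^{(1+κ)/2} ‖∇S(t,t')‖_{C^κ}` (§4.2, proof of Prop. 4.2, the displays from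
"`‖I‖_{Ċ^{1,κ}} ≲ …`" to "We conclude once again by Lemma B.3"), i.e. the PROVED bound carries the
weight `t^{-(1+κ)/2}` in place of `t^{-1/2+ε}`. Feeding the proved bound into the proof of
Prop. 4.3 gives `‖∇T(w)(t)‖_{C^κ} ≲ t^{-1-κ/2+α}(‖w‖_X² + ε₀)`, and the weight `t^{1-α/2}` of the norm
of `X` leaves the factor `t^{(α-κ)/2}`, bounded on `(0,1]` iff `κ ≤ α`. For the paper this is
immaterial (the exponent `κ ∈ (0, 1/2 - 1/(2γ) - 2α)` of §4.1 is at the authors' disposal and may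
be taken `≤ α`; Thm. 1.2 is unaffected), but for the abstraction to arbitrary approximate
solutions it is not: for `κ(1 - 2α) > α` the Stokes response `v` to a residual `F₀` of size
`ε₀t^{-1+α}` carried by frequencies `t^{-1/(2+2κ)}` (both `Y`-slots saturated) is an admissible
`(v, F₀ - v ⊗ v)` for which the only admissible correction is `w = -v`, and
`t^{1-α/2}[∇v(t)]_κ ∼ ε₀ t^{α/2+ακ-κ/2} → ∞` (scaling sketch in the session notes; carried out in
full, with a Kato-class uniqueness argument forcing `w = -v`, in `…PerturbationRefuted`). The
corrected statement (the same statement with the additional hypothesis `κ ≤ α`; in the tree the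
explicit hypothesis `hB` of `CoiculescuPalasek2025_construction_of_parts'`, `…CorrectedAssembly`,
with the assembly re-proved at `κ₂ = min κ α`) consumes the groundwork proved here: the
hypothesis bundle `IsApproximateSolution` is monotone under decreasing `κ`
(`IsApproximateSolution.of_exponent_le`), because for `ℤ³`-periodic functions the Hölder seminorm
is monotone in the exponent with constant `1`, every pair of points of `ℝ³` being within
distance `√3/2 ≤ 1` of a lattice translate (`eHolderNorm_le_of_isLatticePeriodic`).
-/

section HolderExponent

open Literature.Analysis.FunctionSpaces.Torus

variable {F : Type*} [NormedAddCommGroup F]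

/-- Every point of `ℝ³` is within distance `√3/2 ≤ 1` of a `ℤ³`-translate of any other point
(round each coordinate: `|xᵢ - yᵢ - round(xᵢ - yᵢ)| ≤ 1/2`). [folklore] -/
theorem exists_norm_sub_add_latticeVec_le_one (x y : EuclideanSpace ℝ (Fin 3)) :
    ∃ k : Fin 3 → ℤ, ‖x - (y + latticeVec k)‖ ≤ 1 := by
  refine ⟨fun i => round (x i - y i), ?_⟩
  set z : EuclideanSpace ℝ (Fin 3) := x - (y + latticeVec fun i => round (x i - y i)) with hz
  have hcoord : ∀ i, |z i| ≤ 1 / 2 := by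
    intro i
    have h := abs_sub_round (x i - y i)
    have hzi : z i = (x i - y i) - round (x i - y i) := by
      simp only [hz, PiLp.sub_apply, PiLp.add_apply, latticeVec_apply]
      ring
    rwa [hzi]
  have hsum : ∑ i, ‖z i‖ ^ 2 ≤ 3 * (1 / 2 : ℝ) ^ 2 := by
    calc ∑ i, ‖z i‖ ^ 2 ≤ ∑ _i : Fin 3, (1 / 2 : ℝ) ^ 2 :=
          Finset.sum_le_sum fun i _ => by
            rw [Real.norm_eq_abs]
            exact pow_le_pow_left₀ (abs_nonneg _) (hcoord i) 2
      _ = 3 * (1 / 2 : ℝ) ^ 2 := by simp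
  rw [EuclideanSpace.norm_eq]
  calc Real.sqrt (∑ i, ‖z i‖ ^ 2) ≤ Real.sqrt (3 * (1 / 2 : ℝ) ^ 2) := Real.sqrt_le_sqrt hsum
    _ ≤ Real.sqrt 1 := Real.sqrt_le_sqrt (by norm_num)
    _ = 1 := Real.sqrt_one

/-- **Hölder bounds of periodic functions are monotone in the exponent with the same constant**:
a `ℤ³`-periodic `g : ℝ³ → F` that is `r`-Hölder with constant `C` is `r'`-Hölder with constant `C`
for every `r' ≤ r` (pairs at distance `≤ 1`: `d^r ≤ d^{r'}`; pairs at distance `> 1`: translate one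
point by a lattice vector to distance `≤ 1`, `exists_norm_sub_add_latticeVec_le_one`). [folklore] -/
theorem holderWith_of_isLatticePeriodic_of_le {g : EuclideanSpace ℝ (Fin 3) → F} {C r r' : ℝ≥0}
    (hg : IsLatticePeriodic g) (h : HolderWith C r g) (hr' : r' ≤ r) : HolderWith C r' g := by
  rw [holderWith_iff_dist_le] at h ⊢
  intro x y
  rcases le_or_gt (dist x y) 1 with hxy | hxy
  · calc dist (g x) (g y) ≤ C * dist x y ^ (r : ℝ) := h x y
      _ ≤ C * dist x y ^ (r' : ℝ) :=
          mul_le_mul_of_nonneg_left (Real.rpow_le_rpow_of_exponent_ge' dist_nonneg hxy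
            (NNReal.coe_nonneg r') (NNReal.coe_le_coe.2 hr')) C.coe_nonneg
  · obtain ⟨k, hk⟩ := exists_norm_sub_add_latticeVec_le_one x y
    have hper : g (y + latticeVec k) = g y := IsLatticePeriodic.add_latticeVec_holds hg y k
    have hd : dist x (y + latticeVec k) ≤ 1 := by rwa [dist_eq_norm]
    calc dist (g x) (g y) = dist (g x) (g (y + latticeVec k)) := by rw [hper]
      _ ≤ C * dist x (y + latticeVec k) ^ (r : ℝ) := h _ _
      _ ≤ C * 1 := mul_le_mul_of_nonneg_left
          (Real.rpow_le_one dist_nonneg hd (NNReal.coe_nonneg r)) C.coe_nonneg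
      _ ≤ C * dist x y ^ (r' : ℝ) :=
          mul_le_mul_of_nonneg_left (Real.one_le_rpow hxy.le (NNReal.coe_nonneg r')) C.coe_nonneg

/-- **The Hölder seminorm of a `ℤ³`-periodic function is monotone in the exponent**:
`[g]_{r'} ≤ [g]_r` for `r' ≤ r` (Mathlib's `eHolderNorm`; `holderWith_of_isLatticePeriodic_of_le`).
[folklore] -/
theorem eHolderNorm_le_of_isLatticePeriodic {g : EuclideanSpace ℝ (Fin 3) → F}
    (hg : IsLatticePeriodic g) {r r' : ℝ≥0} (hr' : r' ≤ r) :
    eHolderNorm r' g ≤ eHolderNorm r g := by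
  by_cases htop : eHolderNorm r g = ⊤
  · rw [htop]; exact le_top
  have hmem : MemHolder r g := eHolderNorm_ne_top.1 htop
  calc eHolderNorm r' g ≤ nnHolderNorm r g :=
        (holderWith_of_isLatticePeriodic_of_le hg hmem.holderWith hr').eHolderNorm_le
    _ = eHolderNorm r g := hmem.coe_nnHolderNorm_eq_eHolderNorm

/-- The iterated derivatives of the periodic lift of a torus field are `ℤ³`-periodic
(`iteratedFDeriv_comp_add_right` and `Torus.isLatticePeriodic_lift`). [folklore] -/
theorem isLatticePeriodic_iteratedFDeriv_lift {F' : Type*} [NormedAddCommGroup F']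
    [NormedSpace ℝ F'] (f : UnitAddTorus (Fin 3) → F') (n : ℕ) :
    IsLatticePeriodic (iteratedFDeriv ℝ n (lift f)) := by
  intro j x
  have hper : (fun y => lift f (y + EuclideanSpace.single j 1)) = lift f :=
    funext fun y => isLatticePeriodic_lift f j y
  rw [← iteratedFDeriv_comp_add_right n (EuclideanSpace.single j 1) x, hper]

end HolderExponent

/-- **`IsApproximateSolution` is monotone under decreasing the Hölder exponent**: only the
residual clause `t^{1-α}‖F‖_∞ + t^{3/2-α}[∇F]_κ ≤ ε₀` sees `κ`, and `[∇F̃(t)]_{κ'} ≤ [∇F̃(t)]_κ` for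
`κ' ≤ κ` since `∇F̃(t)` (the derivative of the periodic lift) is `ℤ³`-periodic
(`eHolderNorm_le_of_isLatticePeriodic`). [folklore] -/
theorem CoiculescuPalasek2025.IsApproximateSolution.of_exponent_le {T α : ℝ} {κ κ' : ℝ≥0}
    {K : ℕ → ℝ} {C η ε₀ : ℝ} {v : ℝ → UnitAddTorus (Fin 3) → EuclideanSpace ℝ (Fin 3)}
    {F : ℝ → UnitAddTorus (Fin 3) → (Fin 3 → Fin 3 → ℝ)} {π : ℝ → UnitAddTorus (Fin 3) → ℝ}
    (h : IsApproximateSolution T α κ K C η ε₀ v F π) (hκ' : κ' ≤ κ) :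
    IsApproximateSolution T α κ' K C η ε₀ v F π where
  solution := h.solution
  smooth_residual := h.smooth_residual
  residual_symm := h.residual_symm
  hasZeroMean := h.hasZeroMean
  deriv_le := h.deriv_le
  lacunary_le := h.lacunary_le
  residual_le := fun t ht =>
    (add_le_add le_rfl (mul_le_mul' le_rfl (eHolderNorm_le_of_isLatticePeriodic
      (isLatticePeriodic_iteratedFDeriv_lift (F t) 1) hκ'))).trans (h.residual_le t ht)

end Literature.Barriers.NavierStokesRegularity
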